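import Literature.IUT.HodgeArakelov.Rmk111StructuresGenuine
import Literature.AnabelianGeometry.EtaleTheta.Discharge.Sec2CLevelThetaTriviality
import HarnessLib

/-!
# [IUTchII] Rmk. 1.1.1 (iv): the CONJUGATION ACTION of `Π_C(M) = Π^tp_C` on `Π_M|_{(l·Δ_Θ)(M)}` at the genuine
# [EtTh] model frame — constructed, and shown to factor through `Π_C(M) ↠ G(M)` (GAP row G-w4d043-2, (iv)-C, part 1)

Mochizuki, *Inter-universal Teichmüller theory II*, §1, Remark 1.1.1 (iv), kurims manuscript (Dec. 2020) p. 23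
l. 11–31: «the natural conjugation action of `Π_Y(M)` on `Π_M|_{(l·Δ_Θ)(M)}` factors through the natural surjection
`Π_Y(M) ↠ G(M)`. In particular, by applying the natural surjection `Π_C(M) ↠ G(M)`, one may regard `Π_M|_{(l·Δ_Θ)(M)}`
as being equipped with a "naively defined" action by `Π_C(M)` … [which] necessarily coincides with the natural
conjugation action arising from the model embedding `Π_M ↪ Π_μ(M) ⋊ Π_C(M)` [and] with the action of `G(M)` via the
cyclotomic character» [claim: Mochizuki2012, status: disputed] (IUTchII §1 Rmk 1.1.1 (iv), kurims p.23);
[EtTh] Prop. 2.2 (i) p. 37, Cor. 2.19 (i) p. 64 [cite: MochizukiEtTh2009, Cor 2.19 (i) p.64].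

Cell abc-iut, seat abc-iut-w4-d018 (gen 6), by-name row «G-w4d043-2 FLSYMMETRY-GENUINE» (L6-lead §F v1.19au GO
13:43:40Z; GAP-LEDGER G-w4d043-2 = (iv)-C of NODES IUTchII:Rmk1.1.1(iv)). PROOF-ONLY (0 `def`). The typed record
`FlSymmetry.act` is inhabited today by the TRIVIAL action (abc-iut-w5-d219 `FlSymmetry.nonempty_of`, abc-iut-w4-d019
p442142/p442578). THIS FILE constructs, at the [EtTh] model frame of abc-iut-L2-t8's `R := C.rigidData μ hC hS h15 L`
identified (`e`) with a mono-theta environment, for abc-iut-w4-d030's model theta-quotient datum `T`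
(`T.thetaSection = e⁻¹(s^alg(thetaKer))`), THE CONJUGATION ACTION of `Π^tp_C` on `Π_M|_{(l·Δ_Θ)(M)} =
T.envAtTheta.carrier` read through the model embedding `Π_M ≅ Π^tp_{Y̲̲}[μ_N] = μ_N ⋊ Π^tp_{Y̲̲} ↪ μ_N ⋊ Π^tp_C`:

* **`ModelFrame.exists_conjAct`** — there is `act : Π^tp_C →* MulAut (Π_M|_{(l·Δ_Θ)(M)})` PINNED by
  `act c [u] = [v]` whenever `e v = (χ(augC c) · (e u).left, c · (e u).right · c⁻¹)` (the `μ_N`-coordinate through the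
  cyclotomic character `galMuN ∘ augC`, the `Π^tp_{Y̲̲}`-coordinate through abc-iut-L2-d3's restricted inner
  automorphism `conjX c`), such a `v` EXISTS for every `(c, u)` (the `(l·Δ_Θ)`-preimage is `conjX`-stable and lies in
  `Π^tp_X̲̲` under `hker`, stage 1 `Sec2CLevelThetaTriviality`), and **`act c = 1` for every geometric `c`
  (`augC c = 1`)** — the printed «factors through `Π_C(M) ↠ G(M)`» = the typed clause `act_factors` for THIS action
  (`Δ_C(M) = Ker(augC)` at the genuine tower of p442142), by stage 1's `toTheta_conjX_eq_of_mem_lDeltaTheta`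
  (`Δ^tp_C` acts trivially on `l·Δ_Θ`: census C4 + Heisenberg normal form + centrality);
* sequel (stage 3, separate file): the stability of the two sections `s^Θ|`, `s^alg|` of Rmk. 1.1.1 (iii) under this
  action (via stage 1's `thetaMod_conjX_eq` — the cyclotomic character on `Π^tp_C` — and the root clause
  `cocycle_lDeltaTheta`) and the equivariance of the commutator map.

BINDER CENSUS (all BY NAME, no `Prop` fact introduced, no FACT-LIST row consumed): `cl : CLevelData`, census C4
`cl.InvActsByNegOnEll`, `IsEtThOrigin`, `hYcl`, `hker : Ker(Π^tp_X ↠ (Π^tp_X)^Θ) ≤ Π^tp_X̲̲` (abc-iut-w5-d165), the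
model pin `hT` (abc-iut-w4-d030 / w5-d219). HONEST FRAMING: kernel facts about the cell's own typed interfaces and
model; nothing of [IUTchII] is asserted; Rmk. 1.1.1 is outside the [IUTchIII] Cor. 3.12 cone; no side taken on
Cor. 3.12; typed ≠ proved; constructed ≠ endorsed.
-/

noncomputable section

namespace Literature.IUT.HodgeArakelov

open Literature.AnabelianGeometry.EtaleTheta Literature.AnabelianGeometry.SemiGraphs
open scoped Literature.AnabelianGeometry.EtaleTheta

namespace ModelFrame

variable {p : ℕ} [Fact p.Prime] {Mt : MuTwoSetting p}
  {E : Mt.toThetaSetting.EtaleThetaData} {l : ℕ} (C : E.DoubleUnderline l)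
  {S : ThetaSetting.{0}} (μ : Mt.toThetaSetting.CyclotomeMod l S.N)
  (hC : Mt.toThetaSetting.Compat) (hS : Mt.toThetaSetting.Sec2Hyps)
  (h15 : ThetaSetting.Prop15iii E hC) (L : C.CuspLabels)
  (F : ModelFrame S (C.rigidData μ hC hS h15 L)) {Menv : MonoThetaEnv S}
  (e : Menv.Pi ≃ₜ* (C.rigidData μ hC hS h15 L).env) (cl : Mt.CLevelData)

/-- **IUTchII:Rmk1.1.1(iv) — THE CONJUGATION ACTION of `Π_C(M) = Π^tp_C` on `Π_M|_{(l·Δ_Θ)(M)}`, CONSTRUCTED and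
FACTORING THROUGH `Π_C(M) ↠ G(M)`.** At the [EtTh] model frame, for the model theta-quotient datum `T`: there is a
homomorphism `act : Π^tp_C →* MulAut (Π_M|_{(l·Δ_Θ)(M)})` such that (pin) `act c [u] = [v]` whenever
`(e v).left = χ(augC c) · (e u).left` and `(e v).right = c (e u).right c⁻¹` in `Π^tp_X`; (existence) such a `v` in the
`(l·Δ_Θ)`-preimage exists for all `c`, `u`; (factorisation) `act c = 1` whenever `augC c = 1` — «the natural
conjugation action … factors through the natural surjection `Π_C(M) ↠ G(M)` … coincides with the action of `G(M)`
via the cyclotomic character». Inputs BY NAME: census C4, `IsEtThOrigin`, `hYcl`, `hker`.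
[claim: Mochizuki2012, status: disputed] (IUTchII §1 Rmk 1.1.1 (iv), kurims p.23) -/
theorem exists_conjAct (hinv : cl.InvActsByNegOnEll) (hO : Mt.toThetaSetting.IsEtThOrigin)
    (hYcl : (Mt.DtpY.map Mt.toHat.toMonoidHom).topologicalClosure ≤
      Mt.DtpY.map Mt.toHat.toMonoidHom ⊔ (⁅⁅Mt.DeltaHat, Mt.DeltaHat⁆, Mt.DeltaHat⁆).topologicalClosure)
    (hker : Mt.toTheta.ker ≤ C.Huu) (T : ThetaQuotientData (F.reconstruction e))
    (hT : T.thetaSection = (((C.rigidData μ hC hS h15 L).thetaKer.subgroupOf (C.rigidData μ hC hS h15 L).PiY).map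
        (CycEnvelope.algSection (C.rigidData μ hC hS h15 L).augY (C.rigidData μ hC hS h15 L).chi)).comap
          e.toMulEquiv.toMonoidHom) :
    ∃ act : Mt.GtpC →* MulAut T.envAtTheta.carrier,
      (∀ (c : Mt.GtpC) (u v : ↥T.envAtTheta.top),
          (e (v : Menv.Pi)).left = galMuN p S.N (cl.augC c) (e (u : Menv.Pi)).left →
          ((((e (v : Menv.Pi)).right : ↥(C.rigidData μ hC hS h15 L).PiY) : ↥C.Huu) : Mt.PiTemp) =
            cl.conjX c ((((e (u : Menv.Pi)).right : ↥(C.rigidData μ hC hS h15 L).PiY) : ↥C.Huu) : Mt.PiTemp) →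
          act c (QuotientGroup.mk u) = QuotientGroup.mk v) ∧
      (∀ (c : Mt.GtpC) (u : ↥T.envAtTheta.top), ∃ v : ↥T.envAtTheta.top,
          (e (v : Menv.Pi)).left = galMuN p S.N (cl.augC c) (e (u : Menv.Pi)).left ∧
          ((((e (v : Menv.Pi)).right : ↥(C.rigidData μ hC hS h15 L).PiY) : ↥C.Huu) : Mt.PiTemp) =
            cl.conjX c ((((e (u : Menv.Pi)).right : ↥(C.rigidData μ hC hS h15 L).PiY) : ↥C.Huu) : Mt.PiTemp)) ∧
      (∀ c : Mt.GtpC, cl.augC c = 1 → act c = 1) := by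
  classical
  set R : RigidData S.N l := C.rigidData μ hC hS h15 L with hRdef
  -- ### bookkeeping on the model
  have hprojY : ∀ m : Menv.Pi, (F.reconstruction e).projY m = (e m).right := fun m => rfl
  have htop : ∀ m : Menv.Pi, m ∈ T.envAtTheta.top ↔ (((e m).right : ↥R.PiY) : ↥C.Huu) ∈ R.lDeltaTheta :=
    fun m => Iff.rfl
  have hbot : ∀ m : Menv.Pi, m ∈ T.envAtTheta.bot ↔
      e m ∈ ((R.thetaKer.subgroupOf R.PiY).map (CycEnvelope.algSection R.augY R.chi)) := fun m => by
    change m ∈ T.thetaSection ↔ _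
    rw [hT]
    rfl
  have hmemK : ∀ t : ↥C.Huu, t ∈ R.thetaKer ↔ Mt.toTheta (t : Mt.PiTemp) = 1 := fun _ => Iff.rfl
  have haugker : ∀ t : ↥C.Huu, t ∈ R.aug.ker ↔ (t : Mt.PiTemp) ∈ Mt.DeltaTemp := fun t => by
    rw [C.rigidData_aug_ker μ hC hS h15 L, Subgroup.mem_subgroupOf]
  -- the right component of an element of the preimage is geometric
  have hΔ_of_L : ∀ {t : ↥C.Huu}, t ∈ R.lDeltaTheta → t ∈ R.aug.ker := fun ht =>
    (Subgroup.mem_inf.1 (R.lDeltaTheta_le ht)).2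
  have hχ1 : ∀ {y : ↥R.PiY}, ((y : ↥C.Huu) ∈ R.aug.ker) → (R.chi.comp R.augY) y = 1 := fun hy =>
    chi_augY_eq_one_of_mem_ker hy
  -- ### the conjugate of an element of the preimage
  have hu_top : ∀ u : ↥T.envAtTheta.top, (((e (u : Menv.Pi)).right : ↥R.PiY) : ↥C.Huu) ∈ R.lDeltaTheta :=
    fun u => (htop u).1 u.2
  -- right coordinate of the conjugate, as an element of `Π_Y(M) = Π^tp_{Y̲̲}`
  let Yc : Mt.GtpC → ↥T.envAtTheta.top → ↥R.PiY := fun c u =>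
    ⟨⟨cl.conjX c ((((e (u : Menv.Pi)).right : ↥R.PiY) : ↥C.Huu) : Mt.PiTemp),
        C.conjX_mem_Huu_of_mem_lDeltaTheta μ hC hS h15 L cl hker c _ (hu_top u)⟩,
      Subgroup.mem_subgroupOf.2 (C.conjX_mem_GtpY_of_mem_lDeltaTheta μ hC hS h15 L cl c _ (hu_top u))⟩
  have hYc_val : ∀ c u, (((Yc c u : ↥R.PiY) : ↥C.Huu) : Mt.PiTemp) =
      cl.conjX c ((((e (u : Menv.Pi)).right : ↥R.PiY) : ↥C.Huu) : Mt.PiTemp) := fun _ _ => rfl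
  have hYc_L : ∀ c u, ((Yc c u : ↥R.PiY) : ↥C.Huu) ∈ R.lDeltaTheta := fun c u =>
    C.conjX_mem_lDeltaTheta μ hC hS h15 L cl hker c _ (hu_top u)
  -- the conjugate itself, in `Π^tp_{Y̲̲}[μ_N]` and pulled back to `Π_M`
  let W : Mt.GtpC → ↥T.envAtTheta.top → R.env := fun c u =>
    ⟨galMuN p S.N (cl.augC c) (e (u : Menv.Pi)).left, Yc c u⟩
  have hW_top : ∀ c u, e.symm (W c u) ∈ T.envAtTheta.top := fun c u => by
    rw [htop, ContinuousMulEquiv.apply_symm_apply]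
    exact hYc_L c u
  let conjTop : Mt.GtpC → ↥T.envAtTheta.top → ↥T.envAtTheta.top := fun c u => ⟨e.symm (W c u), hW_top c u⟩
  have he_conjTop : ∀ c u, e (conjTop c u : Menv.Pi) = W c u := fun c u => e.apply_symm_apply _
  -- ### the key criterion for equality of classes in `Π_M|_{(l·Δ_Θ)(M)}`
  have hmk_eq : ∀ u v : ↥T.envAtTheta.top, (e (u : Menv.Pi)).left = (e (v : Menv.Pi)).left →
      Mt.toTheta ((((e (u : Menv.Pi)).right : ↥R.PiY) : ↥C.Huu) : Mt.PiTemp) =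
        Mt.toTheta ((((e (v : Menv.Pi)).right : ↥R.PiY) : ↥C.Huu) : Mt.PiTemp) →
      (QuotientGroup.mk u : T.envAtTheta.carrier) = QuotientGroup.mk v := by
    intro u v hl hr
    rw [QuotientGroup.eq, Subgroup.mem_subgroupOf]
    change ((u : Menv.Pi)⁻¹ * v) ∈ T.envAtTheta.bot
    rw [hbot, map_mul, map_inv]
    have hφ : (R.chi.comp R.augY) (e (u : Menv.Pi)).right⁻¹ = 1 := by
      rw [map_inv, hχ1 (hΔ_of_L (hu_top u)), inv_one]
    refine Subgroup.mem_map.2 ⟨(e (u : Menv.Pi)).right⁻¹ * (e (v : Menv.Pi)).right, ?_, ?_⟩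
    · rw [Subgroup.mem_subgroupOf, hmemK, Subgroup.coe_mul, Subgroup.coe_inv, Subgroup.coe_mul, Subgroup.coe_inv,
        map_mul, map_inv, hr, inv_mul_cancel]
    · apply SemidirectProduct.ext
      · rw [SemidirectProduct.mul_left, SemidirectProduct.inv_left, SemidirectProduct.inv_right, hφ,
          MulAut.one_apply, MulAut.one_apply, hl, inv_mul_cancel]
        rfl
      · rw [SemidirectProduct.mul_right, SemidirectProduct.inv_right]
        rfl
  -- ### the conjugation is multiplicative on the preimage
  have hconjTop_mul : ∀ c (u v : ↥T.envAtTheta.top), conjTop c (u * v) = conjTop c u * conjTop c v := by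
    intro c u v
    apply Subtype.ext
    apply e.injective
    change e (conjTop c (u * v) : Menv.Pi) = e ((conjTop c u : Menv.Pi) * (conjTop c v : Menv.Pi))
    rw [map_mul, he_conjTop, he_conjTop, he_conjTop]
    have hφu : (R.chi.comp R.augY) (e (u : Menv.Pi)).right = 1 := hχ1 (hΔ_of_L (hu_top u))
    have hφYu : (R.chi.comp R.augY) (Yc c u) = 1 := hχ1 (hΔ_of_L (hYc_L c u))
    apply SemidirectProduct.ext
    · change galMuN p S.N (cl.augC c) (e ((u : Menv.Pi) * (v : Menv.Pi))).left = _
      rw [map_mul, SemidirectProduct.mul_left, SemidirectProduct.mul_left, hφu, hφYu, MulAut.one_apply,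
        MulAut.one_apply, map_mul]
    · change Yc c (u * v) = Yc c u * Yc c v
      apply Subtype.ext; apply Subtype.ext
      rw [Subgroup.coe_mul, Subgroup.coe_mul, hYc_val, hYc_val, hYc_val]
      change cl.conjX c ((((e ((u : Menv.Pi) * (v : Menv.Pi))).right : ↥R.PiY) : ↥C.Huu) : Mt.PiTemp) = _
      rw [map_mul, SemidirectProduct.mul_right, Subgroup.coe_mul, Subgroup.coe_mul, map_mul]
  have hconjTop_one : ∀ c, conjTop c 1 = 1 := fun c => by
    have h := hconjTop_mul c 1 1
    rw [mul_one] at h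
    exact mul_eq_left.mp h.symm
  -- ### the theta section `bot` is preserved
  have hconjTop_bot : ∀ c (u : ↥T.envAtTheta.top), (u : Menv.Pi) ∈ T.envAtTheta.bot →
      (conjTop c u : Menv.Pi) ∈ T.envAtTheta.bot := by
    intro c u hu
    rw [hbot] at hu ⊢
    obtain ⟨k, hk, hku⟩ := Subgroup.mem_map.1 hu
    rw [Subgroup.mem_subgroupOf] at hk
    have hl : (e (u : Menv.Pi)).left = 1 := by rw [← hku]; rfl
    have hr : (e (u : Menv.Pi)).right = k := by rw [← hku]; rfl
    have hk' := C.conjX_mem_Huu_of_mem_thetaKer μ hC hS h15 L cl hker c (k : ↥C.Huu) hk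
    rw [he_conjTop]
    refine Subgroup.mem_map.2 ⟨Yc c u, ?_, ?_⟩
    · rw [Subgroup.mem_subgroupOf, hmemK, hYc_val, hr]
      exact hk'.2
    · apply SemidirectProduct.ext
      · change (1 : R.mu) = galMuN p S.N (cl.augC c) (e (u : Menv.Pi)).left
        rw [hl, map_one]
      · rfl
  -- ### the endomorphism of the subquotient induced by `c`
  let actTop : Mt.GtpC → (↥T.envAtTheta.top →* ↥T.envAtTheta.top) := fun c =>
    { toFun := conjTop c, map_one' := hconjTop_one c, map_mul' := hconjTop_mul c }
  have hle : ∀ c, T.envAtTheta.bot.subgroupOf T.envAtTheta.top ≤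
      (T.envAtTheta.bot.subgroupOf T.envAtTheta.top).comap (actTop c) := by
    intro c u hu
    rw [Subgroup.mem_comap, Subgroup.mem_subgroupOf]
    exact hconjTop_bot c u (Subgroup.mem_subgroupOf.1 hu)
  let act₀ : Mt.GtpC → (T.envAtTheta.carrier →* T.envAtTheta.carrier) := fun c =>
    QuotientGroup.map _ _ (actTop c) (hle c)
  have hact₀_mk : ∀ c (u : ↥T.envAtTheta.top),
      act₀ c (QuotientGroup.mk u) = QuotientGroup.mk (conjTop c u) := fun c u => rfl
  have hright : ∀ c u, (e (conjTop c u : Menv.Pi)).right = Yc c u := fun c u => by rw [he_conjTop]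
  have hleft : ∀ c u, (e (conjTop c u : Menv.Pi)).left = galMuN p S.N (cl.augC c) (e (u : Menv.Pi)).left :=
    fun c u => by rw [he_conjTop]
  have hconjTop_comp : ∀ c c' u, conjTop (c * c') u = conjTop c (conjTop c' u) := by
    intro c c' u
    apply Subtype.ext
    apply e.injective
    rw [he_conjTop, he_conjTop]
    apply SemidirectProduct.ext
    · change galMuN p S.N (cl.augC (c * c')) (e (u : Menv.Pi)).left =
        galMuN p S.N (cl.augC c) (e (conjTop c' u : Menv.Pi)).left
      rw [hleft, map_mul, map_mul, MulAut.mul_apply]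
    · change Yc (c * c') u = Yc c (conjTop c' u)
      apply Subtype.ext; apply Subtype.ext
      rw [hYc_val, hYc_val, hright, hYc_val, cl.conjX_mul]
  have hconjTop_id : ∀ u, conjTop 1 u = u := by
    intro u
    apply Subtype.ext
    apply e.injective
    rw [he_conjTop]
    apply SemidirectProduct.ext
    · change galMuN p S.N (cl.augC 1) (e (u : Menv.Pi)).left = (e (u : Menv.Pi)).left
      rw [map_one, map_one, MulAut.one_apply]
    · change Yc 1 u = (e (u : Menv.Pi)).right
      apply Subtype.ext; apply Subtype.ext
      rw [hYc_val, cl.conjX_one]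
  have hact₀_mul : ∀ c c', act₀ (c * c') = (act₀ c).comp (act₀ c') := by
    intro c c'
    apply MonoidHom.ext
    intro x
    induction x using QuotientGroup.induction_on with
    | H u => rw [MonoidHom.comp_apply, hact₀_mk, hact₀_mk, hact₀_mk, hconjTop_comp]
  have hact₀_one : act₀ 1 = MonoidHom.id _ := by
    apply MonoidHom.ext
    intro x
    induction x using QuotientGroup.induction_on with
    | H u => rw [MonoidHom.id_apply, hact₀_mk, hconjTop_id]
  have hinv₁ : ∀ c, (act₀ c⁻¹).comp (act₀ c) = MonoidHom.id _ := fun c => by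
    rw [← hact₀_mul, inv_mul_cancel, hact₀_one]
  have hinv₂ : ∀ c, (act₀ c).comp (act₀ c⁻¹) = MonoidHom.id _ := fun c => by
    rw [← hact₀_mul, mul_inv_cancel, hact₀_one]
  let actAut : Mt.GtpC → MulAut T.envAtTheta.carrier := fun c =>
    MonoidHom.toMulEquiv (act₀ c) (act₀ c⁻¹) (hinv₁ c) (hinv₂ c)
  have hactAut : ∀ c x, actAut c x = act₀ c x := fun _ _ => rfl
  refine ⟨{ toFun := actAut, map_one' := ?_, map_mul' := ?_ }, ?_, ?_, ?_⟩
  · apply MulEquiv.ext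
    intro x
    rw [hactAut, hact₀_one, MulAut.one_apply, MonoidHom.id_apply]
  · intro c c'
    apply MulEquiv.ext
    intro x
    rw [MulAut.mul_apply, hactAut, hactAut, hactAut, hact₀_mul, MonoidHom.comp_apply]
  · -- the pin
    intro c u v hl hr
    change actAut c (QuotientGroup.mk u) = QuotientGroup.mk v
    rw [hactAut, hact₀_mk]
    apply hmk_eq
    · rw [hleft, hl]
    · rw [hright, hYc_val, hr]
  · -- existence of the conjugate in the preimage
    intro c u
    exact ⟨conjTop c u, hleft c u, by rw [hright, hYc_val]⟩
  · -- factorisation through `Π_C(M) ↠ G(M)`: geometric elements act trivially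
    intro c hc
    apply MulEquiv.ext
    intro x
    induction x using QuotientGroup.induction_on with
    | H u =>
      change actAut c (QuotientGroup.mk u) = QuotientGroup.mk u
      rw [hactAut, hact₀_mk]
      apply hmk_eq
      · rw [hleft, hc, map_one, MulAut.one_apply]
      · rw [hright, hYc_val]
        exact C.toTheta_conjX_eq_of_mem_lDeltaTheta μ hC hS h15 L cl hinv hO hYcl hc _ (hu_top u)

end ModelFrame

end Literature.IUT.HodgeArakelov

end
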